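import Mathlib
import Literature.Computability.AlgebraicComplexity.DepthThreeChasmAlgebra
import Summits.ValiantsHypothesis.ValiantsHypothesis.Theorems.NewtonTauWeak.Negative.Zonogon

/-!
# `NewtonTauWeak` (stmt-ValiantsHypothesis-5904), line `binomial-normal-form`: the Fischer step

Support file for the crux
`Summit.ValiantsHypothesis.ValiantsHypothesis.Theses.NewtonUnitEquations.NewtonTauWeak`
(KPTT arXiv:1308.2286, Conjecture 1 in the weak form of their Theorem 1: the number `vert` of Newton
vertices of `Σ_{i<k} Π_{j<m} f_ij` for `t`-sparse bivariate `f_ij` over `ℂ` is `≤ 2^{a m}(k t+2)^b`).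

This file proves the registered stub `stub_fischerStep` of the skeleton line `binomial-normal-form`:
a POWERS bound with constants `(a, b)`,
`vert(Σ_{i<k} c_i g_i^m) ≤ 2^{a m}(k t+2)^b` for `t`-sparse `g_i`,
implies the crux's bound with constants `(a + 2b, b)`. This is the device of KPTT's Theorem 3 /
GKKS TR13-026 Lemma 4.3 (Fischer's identity, proved in the tree as
`Literature.Computability.AlgebraicComplexity.DepthThreeChasm.fischer_inv`):
`Π_{j<m} f_j = (2^m m!)⁻¹ Σ_{ε ∈ {±1}^m} (Π_j ε_j)(Σ_j ε_j f_j)^m`, so a sum of `k` products of `m`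
`t`-sparse polynomials is a sum of `k·2^m` scalar multiples of `m`-th powers of `(m t)`-sparse
polynomials; the powers bound with `(k', t') = (k 2^m, m t)` and the arithmetic
`k 2^m · m t + 2 ≤ 4^m (k t+2)` (as `m ≤ 2^m`) give `2^{a m}(4^m (k t+2))^b = 2^{(a+2b) m}(k t+2)^b`.
The degenerate cases `m = 0` and `k = 0` need no separate treatment (Fischer's identity holds for the
empty product, and empty sums are empty sums).

Helper lemmas live in the sub-namespace `FischerStep`; nothing here is a definition or a named fact.

References: P. Koiran, N. Portier, S. Tavenas, S. Thomassé, *A τ-conjecture for Newton polygons*,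
arXiv:1308.2286 (FoCM 15 (2015)), Thm 3; A. Gupta, P. Kamath, N. Kayal, R. Saptharishi, ECCC TR13-026,
Lemma 4.3; I. Fischer, Math. Mag. 67 (1994).
-/

-- the namespace mandated for this Theorems file repeats the component `ValiantsHypothesis`
set_option linter.dupNamespace false

noncomputable section

open scoped BigOperators
open MvPolynomial
open Summit.ValiantsHypothesis.ValiantsHypothesis.Theorems.NewtonTauWeak.Negative
  (vert vert_le_card_support)

namespace Summit.ValiantsHypothesis.ValiantsHypothesis.Theorems.NewtonUnitEquationsNewtonTauWeak

namespace FischerStep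

/-- A sign `(-1)^n` in the polynomial ring is the constant `C ((-1)^n)`. [folklore] -/
theorem neg_one_pow_eq_C (n : ℕ) :
    ((-1 : MvPolynomial (Fin 2) ℂ) ^ n) = C ((-1 : ℂ) ^ n) := by
  rw [C_pow, C_neg, C_1]

/-- Sparsity of a signed sum: if every `y_j` (`j < m`) has at most `t` monomials, then
`Σ_j ±y_j` has at most `m t` monomials (the support of a sum lies in the union of the supports, and a
sign does not enlarge a support). [folklore] -/
theorem card_support_signedSum_le {m t : ℕ} (ε : Fin m → Fin 2)
    (y : Fin m → MvPolynomial (Fin 2) ℂ) (hy : ∀ j, (y j).support.card ≤ t) :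
    (∑ j, (-1 : MvPolynomial (Fin 2) ℂ) ^ (ε j : ℕ) * y j).support.card ≤ m * t := by
  calc (∑ j, (-1 : MvPolynomial (Fin 2) ℂ) ^ (ε j : ℕ) * y j).support.card
      ≤ (Finset.univ.biUnion fun j => ((-1 : MvPolynomial (Fin 2) ℂ) ^ (ε j : ℕ) * y j).support).card :=
        Finset.card_le_card support_sum
    _ ≤ ∑ j, ((-1 : MvPolynomial (Fin 2) ℂ) ^ (ε j : ℕ) * y j).support.card := Finset.card_biUnion_le
    _ ≤ ∑ _j : Fin m, t := Finset.sum_le_sum fun j _ => by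
        rw [neg_one_pow_eq_C, C_mul']
        exact (Finset.card_le_card support_smul).trans (hy j)
    _ = m * t := by simp

/-- **Fischer's identity in powers shape** (GKKS TR13-026 Lemma 4.3 = tree `DepthThreeChasm.fischer_inv`
with `ι = Fin m`, `K = ℂ`, `R = ℂ[X, Y]`, the scalar pulled into one constant):
`Π_{j<m} y_j = Σ_{ε : Fin m → Fin 2} C((2^m m!)⁻¹ Π_j (-1)^{ε_j}) · (Σ_j (-1)^{ε_j} y_j)^m`.
[cite: GuptaKamathKayalSaptharishi2016, Lemma 4.3] -/
theorem prod_eq_sum_C_mul_pow {m : ℕ} (y : Fin m → MvPolynomial (Fin 2) ℂ) :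
    ∏ j, y j = ∑ ε : Fin m → Fin 2,
      C (((2 ^ m * m.factorial : ℕ) : ℂ)⁻¹ * ∏ j, (-1 : ℂ) ^ (ε j : ℕ)) *
        (∑ j, (-1 : MvPolynomial (Fin 2) ℂ) ^ (ε j : ℕ) * y j) ^ m := by
  have h := Literature.Computability.AlgebraicComplexity.DepthThreeChasm.fischer_inv (K := ℂ) y
  rw [Fintype.card_fin] at h
  rw [h, Finset.mul_sum]
  refine Finset.sum_congr rfl fun ε _ => ?_
  simp only [algebraMap_eq, map_mul, map_prod, map_pow, map_neg, map_one]
  ring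

/-- Fischer's identity summed over `i < k`: a sum of `k` products of `m` factors is the sum, over the
pairs `(i, ε) ∈ Fin k × (Fin m → Fin 2)`, of scalar multiples of `m`-th powers of the signed sums
`Σ_j (-1)^{ε_j} f_ij`. [cite: GuptaKamathKayalSaptharishi2016, Lemma 4.3] -/
theorem sum_prod_eq_sum_C_mul_pow {k m : ℕ} (f : Fin k → Fin m → MvPolynomial (Fin 2) ℂ) :
    (∑ i, ∏ j, f i j) = ∑ p : Fin k × (Fin m → Fin 2),
      C (((2 ^ m * m.factorial : ℕ) : ℂ)⁻¹ * ∏ j, (-1 : ℂ) ^ (p.2 j : ℕ)) *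
        (∑ j, (-1 : MvPolynomial (Fin 2) ℂ) ^ (p.2 j : ℕ) * f p.1 j) ^ m := by
  rw [Fintype.sum_prod_type]
  exact Finset.sum_congr rfl fun i _ => prod_eq_sum_C_mul_pow (f i)

/-- The arithmetic of the constants: `2^{a m}(k 2^m · m t + 2)^b ≤ 2^{(a+2b) m}(k t+2)^b`, from
`m ≤ 2^m`, i.e. `k 2^m m t + 2 ≤ 2^{2m}(k t+2)`. [folklore] -/
theorem two_pow_mul_pow_le (a b k m t : ℕ) :
    2 ^ (a * m) * (k * 2 ^ m * (m * t) + 2) ^ b ≤ 2 ^ ((a + 2 * b) * m) * (k * t + 2) ^ b := by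
  have hm : m ≤ 2 ^ m := m.lt_two_pow_self.le
  have key : k * 2 ^ m * (m * t) + 2 ≤ 2 ^ (2 * m) * (k * t + 2) := by
    have e1 : k * 2 ^ m * (m * t) = 2 ^ m * m * (k * t) := by ring
    have e2 : 2 ^ (2 * m) * (k * t + 2) = 2 ^ m * 2 ^ m * (k * t) + 2 ^ m * 2 ^ m * 2 := by
      rw [two_mul, pow_add]; ring
    rw [e1, e2]
    apply Nat.add_le_add
    · exact Nat.mul_le_mul_right _ (Nat.mul_le_mul_left _ hm)
    · calc 2 = 1 * 1 * 2 := by norm_num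
        _ ≤ 2 ^ m * 2 ^ m * 2 :=
          Nat.mul_le_mul_right _ (Nat.mul_le_mul Nat.one_le_two_pow Nat.one_le_two_pow)
  calc 2 ^ (a * m) * (k * 2 ^ m * (m * t) + 2) ^ b
      ≤ 2 ^ (a * m) * (2 ^ (2 * m) * (k * t + 2)) ^ b :=
        Nat.mul_le_mul_left _ (Nat.pow_le_pow_left key b)
    _ = 2 ^ ((a + 2 * b) * m) * (k * t + 2) ^ b := by
        rw [mul_pow, ← mul_assoc, ← pow_mul, ← pow_add,
          show a * m + 2 * m * b = (a + 2 * b) * m by ring]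

end FischerStep

/-- **STUB `stub_fischerStep` of line `binomial-normal-form` (Fischer step, KPTT arXiv:1308.2286 Thm 3
device; GKKS TR13-026 Lemma 4.3).** A powers bound with constants `(a, b)` —
`vert(Σ_{i<k} c_i g_i^m) ≤ 2^{a m}(k t+2)^b` for `t`-sparse `g_i` — gives the crux's bound with constants
`(a + 2b, b)`: `vert(Σ_{i<k} Π_{j<m} f_ij) ≤ 2^{(a+2b) m}(k t+2)^b` for `t`-sparse `f_ij`.
Proof: by Fischer's identity each product `Π_j f_ij` is `Σ_ε C((2^m m!)⁻¹ Π_j (-1)^{ε_j}) (Σ_j (-1)^{ε_j} f_ij)^m`;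
reindex the pairs `(i, ε)` by `Fin (k 2^m)`; every signed sum is `(m t)`-sparse; the hypothesis at
`(k 2^m, m, m t)` gives `vert ≤ 2^{a m}(k 2^m m t + 2)^b ≤ 2^{(a+2b) m}(k t+2)^b`.
[cite: GuptaKamathKayalSaptharishi2016, Lemma 4.3] -/
theorem stub_fischerStep (a b : ℕ)
    (h : ∀ (k m t : ℕ) (c : Fin k → ℂ) (g : Fin k → MvPolynomial (Fin 2) ℂ),
      (∀ i, (g i).support.card ≤ t) → vert (∑ i, C (c i) * g i ^ m) ≤ 2 ^ (a * m) * (k * t + 2) ^ b)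
    (k m t : ℕ) (f : Fin k → Fin m → MvPolynomial (Fin 2) ℂ) (hf : ∀ i j, (f i j).support.card ≤ t) :
    vert (∑ i, ∏ j, f i j) ≤ 2 ^ ((a + 2 * b) * m) * (k * t + 2) ^ b := by
  -- reindex the pairs `(i, ε)` by `Fin (k * 2 ^ m)`
  obtain ⟨e⟩ : Nonempty (Fin (k * 2 ^ m) ≃ Fin k × (Fin m → Fin 2)) :=
    ⟨finProdFinEquiv.symm.trans ((Equiv.refl _).prodCongr finFunctionFinEquiv.symm)⟩
  have key : (∑ i, ∏ j, f i j) = ∑ l : Fin (k * 2 ^ m),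
      C (((2 ^ m * m.factorial : ℕ) : ℂ)⁻¹ * ∏ j, (-1 : ℂ) ^ ((e l).2 j : ℕ)) *
        (∑ j, (-1 : MvPolynomial (Fin 2) ℂ) ^ ((e l).2 j : ℕ) * f (e l).1 j) ^ m :=
    (FischerStep.sum_prod_eq_sum_C_mul_pow f).trans
      (e.sum_comp fun p : Fin k × (Fin m → Fin 2) =>
        C (((2 ^ m * m.factorial : ℕ) : ℂ)⁻¹ * ∏ j, (-1 : ℂ) ^ (p.2 j : ℕ)) *
          (∑ j, (-1 : MvPolynomial (Fin 2) ℂ) ^ (p.2 j : ℕ) * f p.1 j) ^ m).symm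
  rw [key]
  exact (h (k * 2 ^ m) m (m * t) _ _
    fun l => FischerStep.card_support_signedSum_le _ _ (hf (e l).1)).trans
      (FischerStep.two_pow_mul_pow_le a b k m t)

end Summit.ValiantsHypothesis.ValiantsHypothesis.Theorems.NewtonUnitEquationsNewtonTauWeak

end
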